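import Summits.AtomisticToContinuum.FouriersLaw.Theorems.LocalOhmBVBVProfileBoundarySeam

/-!
# Crux `BVProfile` (item stmt-AtomisticToContinuum-12012), line `registered`: the cut is LOSSLESS
# (the crux implies each registered stub)

Converses documenting that the reshaped cut of line `registered` makes no stronger bet than the crux itself: the
statement of `LocalOhmBV.BVProfile` implies
* the total-backflow statement (`totalBackflow_of_bvProfile`, termwise `x⁺ ≤ |x|`; with the landed
  `bvProfile_of_totalBackflow` the crux is EQUIVALENT to an `N`-uniform bound on the total backflow);
* the bulk-backflow stub `stub_boundedBackflow` (`boundedBackflow_of_bvProfile`, `ℓ = 0`);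
* the boundary-layer stub `stub_boundaryBound` (`boundaryBound_of_bvProfile`, `B = 1/2 + max C 0`): choose the full
  response profile by the landed `FiniteResponseProfile_holds`, identify the given limit with its value at `i`
  (uniqueness of limits along `𝓝[≠] 0`), and bound `|θ(i)| ≤ |θ(0)| + Σ_{b<i} |θ(b+1) − θ(b)| ≤ 1/2 + TV` by the landed
  contact passivity `profileBound_contact`.
So `stub_boundaryBound ∧ stub_boundedBackflow ⟺ BVProfile ⟺ bounded total backflow` (all arrows landed). No definitions.
[folklore]
-/

noncomputable section

open Finset

namespace Summit.AtomisticToContinuum.FouriersLaw.Theorems.BVProfileSeam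

/-- Partial variation bound: `|g i − g 0| ≤ Σ_{k<n} |g(k+1) − g(k)|` for `i ≤ n`. [folklore] -/
theorem abs_sub_le_tv (g : ℕ → ℝ) {i n : ℕ} (hi : i ≤ n) :
    |g i - g 0| ≤ ∑ k ∈ range n, |g (k + 1) - g k| := by
  have h1 : |g i - g 0| ≤ ∑ k ∈ range i, |g (k + 1) - g k| := by
    induction i with
    | zero => simp
    | succ m ih =>
      have ih' := ih (by omega)
      rw [Finset.sum_range_succ]
      calc |g (m + 1) - g 0| = |(g m - g 0) + (g (m + 1) - g m)| := by ring_nf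
        _ ≤ |g m - g 0| + |g (m + 1) - g m| := abs_add_le _ _
        _ ≤ (∑ k ∈ range m, |g (k + 1) - g k|) + |g (m + 1) - g m| := by linarith
  exact h1.trans (Finset.sum_le_sum_of_subset_of_nonneg (Finset.range_mono hi)
    (fun k _ _ => abs_nonneg _))

end Summit.AtomisticToContinuum.FouriersLaw.Theorems.BVProfileSeam

namespace Summit.AtomisticToContinuum.FouriersLaw.Theorems

open BVProfileSeam

/-- **The crux implies the total-backflow statement** (termwise `(θ j − θ i)⁺ ≤ |θ j − θ i|`, same constant); with
`bvProfile_of_totalBackflow` the crux `BVProfile` is EQUIVALENT to an `N`-uniform bound on the total backflow.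
[folklore] -/
theorem totalBackflow_of_bvProfile : (∀ ω₂ lam β γ : ℝ, 0 < ω₂ → 0 < lam → 0 < β → 0 < γ → (∀ (N : ℕ) (T_L T_R : ℝ), 0 < T_L → 0 < T_R → ∀ μ ν : MeasureTheory.Measure (Literature.MathematicalPhysics.KineticTheory.HeatConduction.PhaseSpace N), (Literature.MathematicalPhysics.KineticTheory.HeatConduction.pinnedChain ω₂ lam β γ).IsSteadyState N T_L T_R μ → (Literature.MathematicalPhysics.KineticTheory.HeatConduction.pinnedChain ω₂ lam β γ).IsSteadyState N T_L T_R ν → μ = ν) → ∀ μ : (N : ℕ) → ℝ → ℝ → MeasureTheory.Measure (Literature.MathematicalPhysics.KineticTheory.HeatConduction.PhaseSpace N), (∀ (N : ℕ) (T_L T_R : ℝ), 0 < T_L → 0 < T_R → (Literature.MathematicalPhysics.KineticTheory.HeatConduction.pinnedChain ω₂ lam β γ).IsSteadyState N T_L T_R (μ N T_L T_R)) → ∀ T : ℝ, 0 < T → ∃ C : ℝ, ∀ (N : ℕ) (θ : Fin N → ℝ), (∀ i : Fin N, Filter.Tendsto (fun δ : ℝ => ((∫ x, (x.2 i) ^ 2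 ∂(μ N (T + δ / 2) (T - δ / 2))) - ∫ x, (x.2 i) ^ 2 ∂(μ N T T)) / δ) (nhdsWithin 0 {(0 : ℝ)}ᶜ) (nhds (θ i))) → ∑ i : Fin N, ∑ j : Fin N, (if j.val = i.val + 1 then |θ j - θ i| else 0) ≤ C) → (∀ ω₂ lam β γ : ℝ, 0 < ω₂ → 0 < lam → 0 < β → 0 < γ → (∀ (N : ℕ) (T_L T_R : ℝ), 0 < T_L → 0 < T_R → ∀ μ ν : MeasureTheory.Measure (Literature.MathematicalPhysics.KineticTheory.HeatConduction.PhaseSpace N), (Literature.MathematicalPhysics.KineticTheory.HeatConduction.pinnedChain ω₂ lam β γ).IsSteadyState N T_L T_R μ → (Literature.MathematicalPhysics.KineticTheory.HeatConduction.pinnedChain ω₂ lam β γ).IsSteadyState N T_L T_R ν → μ = ν) → ∀ μ : (N : ℕ) → ℝ → ℝ → MeasureTheory.Measure (Literature.MathematicalPhysics.KineticTheory.HeatConduction.PhaseSpace N), (∀ (N : ℕ) (T_L T_R : ℝ), 0 < T_L → 0 < T_R → (Literature.MathematicalPhysics.KineticTheory.HeatConduction.pinnedChain ω₂ lam β γ).IsSteadyState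 N T_L T_R (μ N T_L T_R)) → ∀ T : ℝ, 0 < T → ∃ K : ℝ, ∀ (N : ℕ) (θ : Fin N → ℝ), (∀ i : Fin N, Filter.Tendsto (fun δ : ℝ => ((∫ x, (x.2 i) ^ 2 ∂(μ N (T + δ / 2) (T - δ / 2))) - ∫ x, (x.2 i) ^ 2 ∂(μ N T T)) / δ) (nhdsWithin 0 {(0 : ℝ)}ᶜ) (nhds (θ i))) → ∑ i : Fin N, ∑ j : Fin N, (if j.val = i.val + 1 then max (θ j - θ i) 0 else 0) ≤ K) := by
  intro hBV ω₂ lam β γ hω hl hβ hγ hU μ hμ T hT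
  obtain ⟨C, hC⟩ := hBV ω₂ lam β γ hω hl hβ hγ hU μ hμ T hT
  refine ⟨C, fun N θ hθ => le_trans ?_ (hC N θ hθ)⟩
  refine Finset.sum_le_sum fun i _ => Finset.sum_le_sum fun j _ => ?_
  split_ifs
  · exact max_le (le_abs_self _) (abs_nonneg _)
  · exact le_rfl

/-- **The crux implies the bulk-backflow stub `stub_boundedBackflow`** (with `ℓ = 0` and the same constant).
[folklore] -/
theorem boundedBackflow_of_bvProfile : (∀ ω₂ lam β γ : ℝ, 0 < ω₂ → 0 < lam → 0 < β → 0 < γ → (∀ (N : ℕ) (T_L T_R : ℝ), 0 < T_L → 0 < T_R → ∀ μ ν : MeasureTheory.Measure (Literature.MathematicalPhysics.KineticTheory.HeatConduction.PhaseSpace N), (Literature.MathematicalPhysics.KineticTheory.HeatConduction.pinnedChain ω₂ lam β γ).IsSteadyState N T_L T_R μ → (Literature.MathematicalPhysics.KineticTheory.HeatConduction.pinnedChain ω₂ lam β γ).IsSteadyState N T_L T_R ν → μ = ν) → ∀ μ : (N : ℕ) → ℝ → ℝ → MeasureTheory.Measure (Literature.MathematicalPhysics.KineticTheory.HeatConduction.PhaseSpace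 N), (∀ (N : ℕ) (T_L T_R : ℝ), 0 < T_L → 0 < T_R → (Literature.MathematicalPhysics.KineticTheory.HeatConduction.pinnedChain ω₂ lam β γ).IsSteadyState N T_L T_R (μ N T_L T_R)) → ∀ T : ℝ, 0 < T → ∃ C : ℝ, ∀ (N : ℕ) (θ : Fin N → ℝ), (∀ i : Fin N, Filter.Tendsto (fun δ : ℝ => ((∫ x, (x.2 i) ^ 2 ∂(μ N (T + δ / 2) (T - δ / 2))) - ∫ x, (x.2 i) ^ 2 ∂(μ N T T)) / δ) (nhdsWithin 0 {(0 : ℝ)}ᶜ) (nhds (θ i))) → ∑ i : Fin N, ∑ j : Fin N, (if j.val = i.val + 1 then |θ j - θ i| else 0) ≤ C) → (∀ ω₂ lam β γ : ℝ, 0 < ω₂ → 0 < lam → 0 < β → 0 < γ → (∀ (N : ℕ) (T_L T_R : ℝ), 0 < T_L → 0 < T_R → ∀ μ ν : MeasureTheory.Measure (Literature.MathematicalPhysics.KineticTheory.HeatConduction.PhaseSpace N), (Literature.MathematicalPhysics.KineticTheory.HeatConduction.pinnedChain ω₂ lam β γ).IsSteadyState N T_L T_R μ → (Literature.MathematicalPhysics.KineticTheory.HeatConduction.pinnedChain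 ω₂ lam β γ).IsSteadyState N T_L T_R ν → μ = ν) → ∀ μ : (N : ℕ) → ℝ → ℝ → MeasureTheory.Measure (Literature.MathematicalPhysics.KineticTheory.HeatConduction.PhaseSpace N), (∀ (N : ℕ) (T_L T_R : ℝ), 0 < T_L → 0 < T_R → (Literature.MathematicalPhysics.KineticTheory.HeatConduction.pinnedChain ω₂ lam β γ).IsSteadyState N T_L T_R (μ N T_L T_R)) → ∀ T : ℝ, 0 < T → ∃ (ℓ : ℕ) (K : ℝ), ∀ (N : ℕ) (θ : Fin N → ℝ), (∀ i : Fin N, Filter.Tendsto (fun δ : ℝ => ((∫ x, (x.2 i) ^ 2 ∂(μ N (T + δ / 2) (T - δ / 2))) - ∫ x, (x.2 i) ^ 2 ∂(μ N T T)) / δ) (nhdsWithin 0 {(0 : ℝ)}ᶜ) (nhds (θ i))) → ∑ i : Fin N, ∑ j : Fin N, (if j.val = i.val + 1 ∧ ℓ ≤ i.val ∧ i.val + 1 + ℓ < N then max (θ j - θ i) 0 else 0) ≤ K) := by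
  intro hBV ω₂ lam β γ hω hl hβ hγ hU μ hμ T hT
  obtain ⟨C, hC⟩ := hBV ω₂ lam β γ hω hl hβ hγ hU μ hμ T hT
  refine ⟨0, C, fun N θ hθ => le_trans ?_ (hC N θ hθ)⟩
  refine Finset.sum_le_sum fun i _ => Finset.sum_le_sum fun j _ => ?_
  by_cases hj : j.val = i.val + 1
  · rw [if_pos hj]
    split_ifs
    · exact max_le (le_abs_self _) (abs_nonneg _)
    · exact abs_nonneg _
  · rw [if_neg hj, if_neg (fun h => hj h.1)]

/-- **The crux implies the boundary-layer stub `stub_boundaryBound`** (with `B = 1/2 + max C 0` for every width):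
choose the full response profile `θ` (`FiniteResponseProfile_holds`), identify the given limit `t` with `θ i`
(`tendsto_nhds_unique`), and use `|θ i| ≤ |θ 0| + Σ_{b<i}|θ(b+1) − θ(b)| ≤ 1/2 + TV(θ)` (`profileBound_contact`,
`abs_sub_le_tv`, the crux). [folklore] -/
theorem boundaryBound_of_bvProfile : (∀ ω₂ lam β γ : ℝ, 0 < ω₂ → 0 < lam → 0 < β → 0 < γ → (∀ (N : ℕ) (T_L T_R : ℝ), 0 < T_L → 0 < T_R → ∀ μ ν : MeasureTheory.Measure (Literature.MathematicalPhysics.KineticTheory.HeatConduction.PhaseSpace N), (Literature.MathematicalPhysics.KineticTheory.HeatConduction.pinnedChain ω₂ lam β γ).IsSteadyState N T_L T_R μ → (Literature.MathematicalPhysics.KineticTheory.HeatConduction.pinnedChain ω₂ lam β γ).IsSteadyState N T_L T_R ν → μ = ν) → ∀ μ : (N : ℕ) → ℝ → ℝ → MeasureTheory.Measure (Literature.MathematicalPhysics.KineticTheory.HeatConduction.PhaseSpace N), (∀ (N : ℕ) (T_L T_R : ℝ), 0 < T_L → 0 < T_R → (Literature.MathematicalPhysics.KineticTheory.HeatConduction.pinnedChain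 ω₂ lam β γ).IsSteadyState N T_L T_R (μ N T_L T_R)) → ∀ T : ℝ, 0 < T → ∃ C : ℝ, ∀ (N : ℕ) (θ : Fin N → ℝ), (∀ i : Fin N, Filter.Tendsto (fun δ : ℝ => ((∫ x, (x.2 i) ^ 2 ∂(μ N (T + δ / 2) (T - δ / 2))) - ∫ x, (x.2 i) ^ 2 ∂(μ N T T)) / δ) (nhdsWithin 0 {(0 : ℝ)}ᶜ) (nhds (θ i))) → ∑ i : Fin N, ∑ j : Fin N, (if j.val = i.val + 1 then |θ j - θ i| else 0) ≤ C) → (∀ ω₂ lam β γ : ℝ, 0 < ω₂ → 0 < lam → 0 < β → 0 < γ → (∀ (N : ℕ) (T_L T_R : ℝ), 0 < T_L → 0 < T_R → ∀ μ ν : MeasureTheory.Measure (Literature.MathematicalPhysics.KineticTheory.HeatConduction.PhaseSpace N), (Literature.MathematicalPhysics.KineticTheory.HeatConduction.pinnedChain ω₂ lam β γ).IsSteadyState N T_L T_R μ → (Literature.MathematicalPhysics.KineticTheory.HeatConduction.pinnedChain ω₂ lam β γ).IsSteadyState N T_L T_R ν → μ = ν) → ∀ μ : (N : ℕ) → ℝ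 → ℝ → MeasureTheory.Measure (Literature.MathematicalPhysics.KineticTheory.HeatConduction.PhaseSpace N), (∀ (N : ℕ) (T_L T_R : ℝ), 0 < T_L → 0 < T_R → (Literature.MathematicalPhysics.KineticTheory.HeatConduction.pinnedChain ω₂ lam β γ).IsSteadyState N T_L T_R (μ N T_L T_R)) → ∀ T : ℝ, 0 < T → ∀ ℓ : ℕ, ∃ B : ℝ, ∀ (N : ℕ) (i : Fin N) (t : ℝ), (i.val ≤ ℓ ∨ N ≤ i.val + 1 + ℓ) → Filter.Tendsto (fun δ : ℝ => ((∫ x, (x.2 i) ^ 2 ∂(μ N (T + δ / 2) (T - δ / 2))) - ∫ x, (x.2 i) ^ 2 ∂(μ N T T)) / δ) (nhdsWithin 0 {(0 : ℝ)}ᶜ) (nhds t) → |t| ≤ B) := by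
  intro hBV ω₂ lam β γ hω hl hβ hγ hU μ hμ T hT ℓ
  obtain ⟨C, hC⟩ := hBV ω₂ lam β γ hω hl hβ hγ hU μ hμ T hT
  refine ⟨1 / 2 + max C 0, fun N i t _ ht => ?_⟩
  -- the full response profile exists (landed `FiniteResponseProfile_holds`)
  have hex : ∀ j : Fin N, ∃ s : ℝ, Filter.Tendsto (fun δ : ℝ => ((∫ x, (x.2 j) ^ 2 ∂(μ N (T + δ / 2) (T - δ / 2))) -
      ∫ x, (x.2 j) ^ 2 ∂(μ N T T)) / δ) (nhdsWithin 0 {(0 : ℝ)}ᶜ) (nhds s) := fun j =>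
    Summit.AtomisticToContinuum.FouriersLaw.Theses.LocalOhmBV.FiniteResponseProfile_holds ω₂ lam β γ hω hl hβ hγ hU μ hμ
      T hT N j
  choose θ hθ using hex
  have hti : θ i = t := tendsto_nhds_unique (hθ i) ht
  -- zero extension and the total variation bound from the crux
  set g : ℕ → ℝ := fun k => if h : k < N then θ ⟨k, h⟩ else 0 with hg_def
  have hg : ∀ j : Fin N, g j.val = θ j := fun j => by simp [hg_def, j.isLt]
  have hTV : (∑ k ∈ range (N - 1), |g (k + 1) - g k|) ≤ C := by
    rw [← tv_sum_eq θ g hg]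
    exact hC N θ hθ
  have h0N : 0 < N := Fin.pos i
  have h0 : |g 0| ≤ 1 / 2 := by
    rw [hg ⟨0, h0N⟩]
    exact profileBound_contact ω₂ lam β γ hω hl hβ hγ hU μ hμ T hT N ⟨0, h0N⟩ (θ ⟨0, h0N⟩) (Or.inl rfl) (hθ ⟨0, h0N⟩)
  have hvar : |g i.val - g 0| ≤ C := (abs_sub_le_tv g (show i.val ≤ N - 1 by omega)).trans hTV
  rw [← hti, ← hg i]
  calc |g i.val| = |g 0 + (g i.val - g 0)| := by ring_nf
    _ ≤ |g 0| + |g i.val - g 0| := abs_add_le _ _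
    _ ≤ 1 / 2 + C := add_le_add h0 hvar
    _ ≤ 1 / 2 + max C 0 := by linarith [le_max_left C 0]

end Summit.AtomisticToContinuum.FouriersLaw.Theorems

end
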